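import Summits.RiemannHypothesis.RiemannHypothesis.Theorems.OddSectorOddOneSignedWindowsOriginLayer
import Summits.RiemannHypothesis.RiemannHypothesis.Theorems.OddSectorOddOneSignedWindowsRenorm
import Summits.RiemannHypothesis.RiemannHypothesis.Theorems.OddSectorOddOneSignedWindowsExistence
import HarnessLib

/-!
# The crux `OddSector.OddOneSignedWindows` is equivalent to its robust bulk form
(line `Sketch` of crux stmt-RiemannHypothesis-17778; RH-free)

The origin-layer lemma (`stub_originLayerLemma`, Theorems/OddSectorOddOneSignedWindowsOriginLayer)
removes the origin layer from the crux: for every layer width `0 < η ≤ log 2`,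

  `OddOneSignedWindows ↔ ∀ A, ∃ a ≥ max(A, 1), ∃ u` real odd-sector ground state at `a` with
  `Re u ≥ 0` a.e. on the BULK `[η, a)` and the layer domination
  `layerPrimeDefect a u x ≤ layerArchGlue a η u x` for a.e. `x ∈ (0, η)` with `Re u(x) < 0`

(`oddOneSignedWindows_iff_bulkSignPattern`). `←` is the origin-layer lemma (fold `u` to
`sign·|u|`); `→` is immediate: a one-signed real odd ground state (which the crux provides in
pointwise-real form, `oddOneSignedWindows_iff_real_nonneg`) satisfies the bulk clause, and the
domination clause vacuously. In particular the RH-strength stub `stub_oddBulkSignPattern` of the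
line skeleton (the case `η = 1/20`) is EQUIVALENT to the crux
(`stub_oddOneSignedWindows_iff_bulkSignPattern`): the line `Sketch` reduces the crux to itself in
robust form — the resonant failures of one-signedness in the origin layer (2001 §10, `a = log q`)
are exactly the windows where domination fails, and nothing RH-free is left in the line.
-/

noncomputable section

set_option linter.dupNamespace false

open MeasureTheory Set Filter
open scoped Topology

namespace Summit.RiemannHypothesis.RiemannHypothesis.Theorems.OddSector

open Literature.NumberTheory.LFunctions
open Summit.RiemannHypothesis.RiemannHypothesis.Theses.OddSector (OddOneSignedWindows)

/-- **The crux is its robust bulk form** (RH-free): for every layer width `0 < η ≤ log 2`,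
`OddOneSignedWindows` holds iff beyond every height some window `a ≥ 1` carries a real odd-sector
ground state which is `≥ 0` a.e. on the bulk `[η, a)` and satisfies the layer domination
`layerPrimeDefect ≤ layerArchGlue` a.e. on the part of `(0, η)` where it is negative. -/
theorem oddOneSignedWindows_iff_bulkSignPattern {η : ℝ} (hη : 0 < η) (hηlog : η ≤ Real.log 2) :
    OddOneSignedWindows ↔
      ∀ A : ℝ, ∃ a : ℝ, A ≤ a ∧ 1 ≤ a ∧ ∃ u : ℝ → ℂ, IsWeilOddGroundState a u ∧
        (∀ t, (u t).im = 0) ∧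
        (∀ᵐ t : ℝ, t ∈ Ico η a → 0 ≤ (u t).re) ∧
        (∀ᵐ x : ℝ, x ∈ Ioo 0 η → (u x).re < 0 →
          layerPrimeDefect a u x ≤ layerArchGlue a η u x) := by
  have hη1 : η < 1 := by
    have h2 : Real.log 2 < 1 := by
      have := Real.log_two_lt_d9
      linarith
    linarith
  constructor
  · intro H A
    obtain ⟨a, hAa, v, hv, hreal, hsign⟩ := (oddOneSignedWindows_iff_real_nonneg.1 H) (max A 1)
    refine ⟨a, le_trans (le_max_left _ _) hAa, le_trans (le_max_right _ _) hAa, v, hv, hreal,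
      ?_, ?_⟩
    · filter_upwards [hsign] with t ht htI
      exact ht ⟨hη.trans_le htI.1, htI.2⟩
    · have h1a : 1 ≤ a := le_trans (le_max_right _ _) hAa
      filter_upwards [hsign] with x hx hxI hneg
      exact absurd (hx ⟨hxI.1, hxI.2.trans (hη1.trans_le h1a)⟩) (not_le.2 hneg)
  · intro H
    rw [oddOneSignedWindows_iff]
    intro A
    obtain ⟨a, hAa, h1a, u, hu, hreal, hbulk, hdom⟩ := H A
    have hηa : η < a := hη1.trans_le h1a
    have hv := stub_originLayerLemma a η u hη hηlog hηa hu hreal hbulk hdom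
    refine ⟨a, hAa, _, hv, Eventually.of_forall fun t ht ↦ ⟨?_, ?_⟩⟩
    · simp only [Complex.ofReal_im]
    · simp only [Complex.ofReal_re, Real.sign_of_pos ht.1, one_mul]
      exact norm_nonneg _

/-- **The RH-strength stub of the line skeleton is equivalent to the crux** (registered stub
`stub_oddOneSignedWindows_iff_bulkSignPattern`; the case `η = 1/20` of
`oddOneSignedWindows_iff_bulkSignPattern`). -/
theorem stub_oddOneSignedWindows_iff_bulkSignPattern :
    OddOneSignedWindows ↔
      ∀ A : ℝ, ∃ a : ℝ, A ≤ a ∧ 1 ≤ a ∧ ∃ u : ℝ → ℂ, IsWeilOddGroundState a u ∧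
        (∀ t, (u t).im = 0) ∧
        (∀ᵐ t : ℝ, t ∈ Ico (1 / 20 : ℝ) a → 0 ≤ (u t).re) ∧
        (∀ᵐ x : ℝ, x ∈ Ioo (0 : ℝ) (1 / 20) → (u x).re < 0 →
          layerPrimeDefect a u x ≤ layerArchGlue a (1 / 20) u x) :=
  oddOneSignedWindows_iff_bulkSignPattern (by norm_num) (by linarith [Real.log_two_gt_d9])

end Summit.RiemannHypothesis.RiemannHypothesis.Theorems.OddSector

end
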